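import Summits.ResolutionOfSingularities.ResolutionOfSingularities.Theorems.MaxContactCutConeCut
import HarnessLib

/-!
# MaxContactCutConeCutCells — tree file 11/11 (Theses cone): §D continued — zigzag / all-repeat / rigid cells DECIDED
(`noZigzagTails_holds`, `noAllRepeatTails_holds`, `noRigidAllRepeatTails_holds`), the MIXED residual
`coneLine_iff_mixed`, LAW E re-typing
`mixed_iff_tame` (EXACT), 31770 ⟺ NoRigidFreeHighFloorsDeep ∧ NoTameMixedTailsDeep mod the landed pieces, 31870,
and §E ROOT BY NAME.

Content VERBATIM from the decomp-res lens-3 g15 file `HOME/decomp-res-lens-3/g15/parts/ConeCut-rev5-f76e5309.lean`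
(sha256 f76e53096babc227…; CRITIC-LEDGER
rows 102/105/110/123 CLEARED, landing orders 15:53:15Z / 17:40:15Z).  HOME = run/shared/lean/pub/decomp-res.  Host:
route `MaxContactCut`, aside
31770 `DefectWalksDeep` (and 31870) through the tree's lens-3 g14 `Theorems/FloorCut{Classes,Floor}` + `MaxContactCutFloorCut`.

[WRITER NOTE (decomp-res writer g6): per the lens's own landing instruction its §0 (l.130–876 = g14 `FloorCut`
VERBATIM) is DELETED and the
tree's `…Theorems.FloorCut` opened instead; §C⁵ `section AxisLaw` (l.2949–3086) is the tree's
`Theorems/ConeCutAxisLaw` (landed earlier,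
opened here); the restated ProximityCut letters `LeavesNewest` / `StaysOnNewest` / `leavesNewest_iff_not_stays` /
`NoFreePointTailsDeep`
(byte-identical to `Theorems/ProximityCutClasses`) are deleted and opened from the tree; the three class definitions
`IsTameFrom`,
`NoMixedTailsDeep`, `NoTameMixedTailsDeep` live in the cone-free `Theorems/ConeCutClasses` (so the route can import
the co-owned MIXED
aside).  Split: ConeCutClasses · ConeCutLayers / ConeCutLayersPoint (§A state level) · ConeCutWalks (§B) ·
ConeCutLawB (§C) · ConeCutRepeats
(§B⁺, §B⁺⁺⁺ part 1) · ConeCutLawE (§B⁺⁺⁺ part 2, LAW E) · ConeCutZigzag (§B⁺⁺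
Fibonacci/zigzag, LAW C) · ConeCutLaws (all-repeat rigidity,
LAW I, §D booking) · MaxContactCutConeCut / MaxContactCutConeCutCells (§D wiring to 31770/31870 BY NAME, Theses
cone).  ONE namespace
`…Theorems.ConeCut` as in the lens; global `set_option` lines dropped; nothing else changed.  The lens's by-name re-export `closes` (≡ the landed
`MaxContactCutExponentLadder.closes`) is not restated: cite that theorem.]
(Sources: Hauser2010 §§D,F,G; HauserPerlega2019; Moh1987; CossartPiltant2019; CossartJannsenSaito2020 Thm. 2.14,
§§5,9; BenitoVillamayor2013 §7; CasasAlvero2000 Ch. 3; BierstoneGrigorievMilmanWlodarczyk2011 Def. 3.1.3.)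
-/

noncomputable section

open MvPolynomial Finset
open Literature.AlgebraicGeometry.Resolution
open Literature.AlgebraicGeometry.Resolution.Hauser2010
open Literature.AlgebraicGeometry.Resolution.PointBlowup
open Summit.ResolutionOfSingularities.ResolutionOfSingularities.Theorems.TightDefectClasses
open Summit.ResolutionOfSingularities.ResolutionOfSingularities.Theorems.TightDefectStrongWalks
open Summit.ResolutionOfSingularities.ResolutionOfSingularities.Theorems.ItineraryCutClasses
open Summit.ResolutionOfSingularities.ResolutionOfSingularities.Theorems.BoundaryLedger
open Literature.AlgebraicGeometry.Resolution.WeightedBlowup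
open Literature.Barriers.ResolutionOfSingularities
open Summit.ResolutionOfSingularities.ResolutionOfSingularities.Theorems.FloorCut
open Summit.ResolutionOfSingularities.ResolutionOfSingularities.Theorems.ConeCutAxisLaw
open Summit.ResolutionOfSingularities.ResolutionOfSingularities.Theorems.ProximityCut (NoOriginTails LeavesNewest StaysOnNewest)
open Summit.ResolutionOfSingularities.ResolutionOfSingularities.Theorems.ProximityCut (leavesNewest_iff_not_stays NoFreePointTailsDeep)
open Summit.ResolutionOfSingularities.ResolutionOfSingularities.Theorems.ExitLaw (fin3_cases)

namespace Summit.ResolutionOfSingularities.ResolutionOfSingularities.Theorems.ConeCut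

/-- Necessity of the mixed cell (by letter). [folklore] -/
theorem mixed_of_repeatHigh (h : NoRepeatHighPlateauxDeepTwo) : NoMixedTailsDeep :=
  fun p hp e he K _ _ _ _ s₀ hs W N s h2 hsq hplat htr hR _ => h p hp e he K s₀ hs W N s h2 hsq hplat htr hR

/-- **THE WORD SPLIT (PROVED, EXACT)**: a repeat-recurrent tail is eventually all-repeat or mixed. [folklore] -/
theorem repeatHigh_iff_allRepeat_mixed :
    NoRepeatHighPlateauxDeepTwo ↔ NoAllRepeatTailsDeep ∧ NoMixedTailsDeep := by
  refine ⟨fun h => ⟨allRepeat_of_repeatHigh h, mixed_of_repeatHigh h⟩, ?_⟩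
  rintro ⟨hA, hX⟩ p hp e he K _ _ _ _ s₀ hs W N s h2 hsq hplat htr hR
  by_cases hall : ∃ M, N ≤ M ∧ ∀ t, M ≤ t → StaysOnNewest W t
  · exact hA p hp e he K s₀ hs W N s h2 hsq hplat htr hall
  · push Not at hall
    refine hX p hp e he K s₀ hs W N s h2 hsq hplat htr hR fun M₀ => ?_
    obtain ⟨t, ht, hnot⟩ := hall (max M₀ N) (le_max_right _ _)
    exact ⟨t, (le_max_left _ _).trans ht, leavesNewest_of_not_stays W t hnot⟩

/-- The rigid core is an all-repeat tail (by letter). [folklore] -/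
theorem rigidAllRepeat_of_allRepeat (h : NoAllRepeatTailsDeep) : NoRigidAllRepeatTailsDeep := by
  intro p hp e he K _ _ _ _ s₀ hs W N s h2 hsq hplat htr _ hrig
  obtain ⟨M, hNM, hR, -⟩ := hrig
  exact h p hp e he K s₀ hs W N s h2 hsq hplat htr ⟨M, hNM, hR⟩

/-- **LAW C⁺ RE-LOCATES the all-repeat cell to its rigid core (PROVED).** [new] [folklore] -/
theorem allRepeat_of_rigid (h : NoRigidAllRepeatTailsDeep) : NoAllRepeatTailsDeep := by
  intro p hp e he K _ _ _ _ s₀ hs W N s h2 hsq hplat htr hall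
  obtain ⟨M, hNM, hR⟩ := hall
  have hlt := lt_two_mul_shade_of_allRepeat hs W (by omega) hsq hplat htr hNM hR
  obtain ⟨M', hMM', hrig⟩ := allRepeat_rigid hs W (by omega) hsq hplat htr hNM hR
  exact h p hp e he K s₀ hs W N s h2 hsq hplat htr hlt ⟨M', by omega, fun t ht => hR t (by omega), hrig⟩

/-- **EXACT**: all-repeat cell ≡ rigid all-repeat core. [new] [folklore] -/
theorem allRepeat_iff_rigid : NoAllRepeatTailsDeep ↔ NoRigidAllRepeatTailsDeep :=
  ⟨rigidAllRepeat_of_allRepeat, allRepeat_of_rigid⟩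

/-- **DECIDED (LAW C⁺): all-repeat tails of shade `s ≤ q/2` do not exist.** [new] [folklore] -/
theorem noLowAllRepeatTails_holds : NoLowAllRepeatTailsDeep := by
  intro p hp e he K _ _ _ _ s₀ hs W N s h2 hsq hplat htr hlow hall
  obtain ⟨M, hNM, hR⟩ := hall
  have hlt := lt_two_mul_shade_of_allRepeat hs W (by omega) hsq hplat htr hNM hR
  omega

/-- The zigzag cells of rev 2 are sub-cells of the all-repeat cell (by letter). [folklore] -/
theorem zigzag_of_allRepeat (h : NoAllRepeatTailsDeep) : NoZigzagTailsDeep := by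
  intro p hp e he K _ _ _ _ s₀ hs W N s h2 hsq hplat htr hz
  obtain ⟨M, hNM, hM⟩ := hz
  exact h p hp e he K s₀ hs W N s h2 hsq hplat htr ⟨M, hNM, fun t ht => (hM t ht).1⟩

/-- **THE ALL-REPEAT CORE IS EMPTY (PROVED, rev 4 — LAW E).**  An all-repeat tail on a high plateau is translation-free
from its third step on (`third_repeat_plateau`), contradicting translations i.o.:  `NoAllRepeatTailsDeep` holds for
EVERY `q = p^e` and every `s` — the golden rigid core `NoRigidAllRepeatTailsDeep` of rev 3 is empty too. [new] [folklore] -/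
theorem noAllRepeatTails_holds : NoAllRepeatTailsDeep := by
  intro p hp e he K _ _ _ _ s₀ hs W N s h2 hsq hplat htr hall
  obtain ⟨M, hNM, hR⟩ := hall
  obtain ⟨i, hi, hb⟩ := htr (M + 3)
  have h := (third_repeat_plateau hs W (by omega) hplat (t := i - 3) (by omega) (hR _ (by omega)) (hR _ (by omega))
    (hR _ (by omega))).1
  rw [show i - 3 + 3 = i by omega] at h
  exact hb h

/-- **DECIDED (LAW E): the rigid all-repeat core is EMPTY.** [new] [folklore] -/
theorem noRigidAllRepeatTails_holds : NoRigidAllRepeatTailsDeep :=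
  rigidAllRepeat_of_allRepeat noAllRepeatTails_holds

/-- **DECIDED (LAW E): zigzag tails do not exist.** [new] [folklore] -/
theorem noZigzagTails_holds : NoZigzagTailsDeep :=
  zigzag_of_allRepeat noAllRepeatTails_holds

/-- **THE REPEAT HALF, LOCATED (PROVED, EXACT)**: ≡ rigid all-repeat core ∧ mixed words. [new] [folklore] -/
theorem repeatHigh_iff_rigid_mixed :
    NoRepeatHighPlateauxDeepTwo ↔ NoRigidAllRepeatTailsDeep ∧ NoMixedTailsDeep := by
  rw [repeatHigh_iff_allRepeat_mixed, allRepeat_iff_rigid]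

/-- **The cone-line residual of rev 0, LOCATED one level deeper (PROVED, EXACT).** [new] [folklore] -/
theorem coneLine_iff_rigid_mixed :
    NoConeLineRepeatHighPlateauxDeep ↔ NoRigidAllRepeatTailsDeep ∧ NoMixedTailsDeep := by
  rw [← repeatHigh_iff_coneLine, repeatHigh_iff_rigid_mixed]

/-- **THE SYMMETRIC CUT OF THE HIGH REGIME (PROVED, EXACT)**: `NoHighPlateauxDeepTwo` ≡ (rigid free floors: ONE hugged
component of mass `q − s`, order `q + a`) ∧ (rigid all-repeat tails: TWO hugged components of mass `q − s`, order
`2q − s`, `2s > q`) ∧ (mixed words). [new] [folklore] -/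
theorem highTwo_iff_three :
    NoHighPlateauxDeepTwo ↔ NoRigidFreeHighFloorsDeep ∧ NoRigidAllRepeatTailsDeep ∧ NoMixedTailsDeep := by
  rw [highTwo_iff_free_repeat, freeHigh_iff_rigid, repeatHigh_iff_rigid_mixed]

/-- **THE HIGH REGIME RE-LOCATED (PROVED, EXACT, rev 4 — LAW E)**: with the all-repeat core empty,
`NoHighPlateauxDeepTwo ≡ NoRigidFreeHighFloorsDeep ∧ NoMixedTailsDeep` — rigid free floors (one hugged component of
mass `q − s`, arc-law port) and MIXED WORDS (both letters i.o.; by LAW E every repeat run of length `≥ 3` ends in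
untranslated zigzag steps, so the translations of a mixed word sit at F-moves and at the first two repeats of each
run). [new] [folklore] -/
theorem highTwo_iff_free_mixed : NoHighPlateauxDeepTwo ↔ NoRigidFreeHighFloorsDeep ∧ NoMixedTailsDeep := by
  rw [highTwo_iff_three]
  exact ⟨fun h => ⟨h.1, h.2.2⟩, fun h => ⟨h.1, noRigidAllRepeatTails_holds, h.2⟩⟩

/-- **The repeat half ≡ mixed words (PROVED, EXACT, rev 4).** [new] [folklore] -/
theorem repeatHigh_iff_mixed : NoRepeatHighPlateauxDeepTwo ↔ NoMixedTailsDeep := by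
  rw [repeatHigh_iff_rigid_mixed]
  exact ⟨fun h => h.2, fun h => ⟨noRigidAllRepeatTails_holds, h⟩⟩

/-- **The cone-line residual of rev 0 ≡ mixed words (PROVED, EXACT, rev 4).** [new] [folklore] -/
theorem coneLine_iff_mixed : NoConeLineRepeatHighPlateauxDeep ↔ NoMixedTailsDeep := by
  rw [coneLine_iff_rigid_mixed]
  exact ⟨fun h => h.2, fun h => ⟨noRigidAllRepeatTails_holds, h⟩⟩

/-! ### §D.4e LAW E re-types the MIXED residual as TAME mixed words (g15 rev 4) -/

/-- By letter. [folklore] -/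
theorem tameMixed_of_mixed (h : NoMixedTailsDeep) : NoTameMixedTailsDeep :=
  fun p hp e he K _ _ _ _ s₀ hs W N s h2 hsq hplat htr hR hF _ => h p hp e he K s₀ hs W N s h2 hsq hplat htr hR hF

/-- **LAW E RE-TYPES THE MIXED RESIDUAL (PROVED, EXACT)**: `NoMixedTailsDeep ↔ NoTameMixedTailsDeep`. [new] [folklore] -/
theorem mixed_iff_tame : NoMixedTailsDeep ↔ NoTameMixedTailsDeep :=
  ⟨tameMixed_of_mixed, fun h p hp e he K _ _ _ _ s₀ hs W N s h2 hsq hplat htr hR hF =>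
    h p hp e he K s₀ hs W N s h2 hsq hplat htr hR hF (isTameFrom_of_plateau hs W (by omega) hplat)⟩

/-- **THE HIGH REGIME, rev 4, fully typed (PROVED, EXACT)**: rigid free floors ∧ tame mixed words. [new] [folklore] -/
theorem highTwo_iff_free_tame : NoHighPlateauxDeepTwo ↔ NoRigidFreeHighFloorsDeep ∧ NoTameMixedTailsDeep := by
  rw [highTwo_iff_free_mixed, mixed_iff_tame]

/-- The cone-line residual of rev 0 ≡ tame mixed words (PROVED, EXACT). [new] [folklore] -/
theorem coneLine_iff_tame : NoConeLineRepeatHighPlateauxDeep ↔ NoTameMixedTailsDeep := by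
  rw [coneLine_iff_mixed, mixed_iff_tame]

/-! ### §D.5 Relation to lens-5 g15's joint residual: IDENTICAL IN KERNEL -/

/-- lens-5's joint residual gives the repeat half (by letter + positivity of shades from the plateau, tree no-jump).
[folklore] -/
theorem repeatHigh_of_joint (hJ : NoRepeatTranslationRecurrentExcessPlateauxDeep) : NoRepeatHighPlateauxDeepTwo := by
  intro p hp e he K _ _ _ _ s₀ hs W N s h2 hsq hplat htr hrep
  have hpos : ∀ i, 1 ≤ (W.st i).shade :=
    hpos_of_plateau shadeNeverIncreases_holds hp (one_le_two.trans he) hs W (fun t ht => (hplat t ht).1) (by omega)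
  refine hJ p hp e he K s₀ hs W hpos N (fun t ht => ?_) (fun t ht => (hplat t ht).2.ne') hrep htr
  rw [(hplat (t + 1) (by omega)).1, (hplat t ht).1]

/-- The repeat half gives lens-5's joint residual (PROVED: the plateau of a repeat-recurrent tail above order `q` has
height `2 ≤ s ≤ q−1` — `s ≥ 1` by positivity, `s ≠ 1` by g14's PROVED `noHighPlateaux_shade_one`, `s < q` because
high repeats are satellites (`satellite_succ_of_stays`, `plateau_lt_of_satellite_io`)). [new] [folklore] -/
theorem joint_of_repeatHigh (h : NoRepeatHighPlateauxDeepTwo) : NoRepeatTranslationRecurrentExcessPlateauxDeep := by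
  intro p hp e he K _ _ _ _ s₀ hs W hpos N hN hne hrep htr
  classical
  have hconst : ∀ t, N ≤ t → (W.st t).shade = (W.st N).shade := by
    intro t ht
    induction t, ht using Nat.le_induction with
    | base => rfl
    | succ t ht ih => exact (hN t ht).trans ih
  obtain ⟨o, ho, -⟩ := walk_nat hs W N
  obtain ⟨s, hsN, -⟩ := order_eq_shade_add_degree hs W N ho
  have hplat : ∀ t, N ≤ t → (W.st t).shade = (s : ℕ∞) := fun t ht => (hconst t ht).trans hsN
  have hhigh : ∀ t, N ≤ t → (W.st t).shade = (s : ℕ∞) ∧ ((p ^ e : ℕ) : ℕ∞) < ordZero (W.st t).F := by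
    intro t ht
    refine ⟨hplat t ht, ?_⟩
    obtain ⟨o', ho', hqo'⟩ := walk_nat hs W t
    rw [ho']
    have hne' : p ^ e ≠ o' := fun h' => hne t ht (by rw [ho', h'])
    exact_mod_cast lt_of_le_of_ne hqo' hne'
  have h1 : 1 ≤ s := by
    have h1' := hpos N
    rw [hsN] at h1'
    exact_mod_cast h1'
  have hsat : ∀ M : ℕ, ∃ t, M ≤ t ∧ W.Satellite t := by
    intro M
    obtain ⟨t, ht, hS⟩ := hrep (max M N)
    obtain ⟨o', ho', -⟩ := walk_nat hs W t
    have hqo' : p ^ e < o' := by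
      have h' := (hhigh t (le_of_max_le_right ht)).2
      rw [ho'] at h'
      exact_mod_cast h'
    exact ⟨t + 1, (le_of_max_le_left ht).trans (Nat.le_succ t), satellite_succ_of_stays W t ho' hqo' hS⟩
  have hsq : s < p ^ e := plateau_lt_of_satellite_io hs W hplat hsat
  have h2 : 2 ≤ s := by
    by_contra hlt
    have hs1 : s = 1 := by omega
    subst hs1
    exact noHighPlateaux_shade_one hs W hhigh htr
  exact h p hp e he K s₀ hs W N s h2 hsq hhigh htr hrep

/-- **lens-5 g15's joint residual ⟺ the repeat half of g14's residual (PROVED, kernel-only).** [new] [folklore] -/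
theorem joint_iff_repeatHigh : NoRepeatTranslationRecurrentExcessPlateauxDeep ↔ NoRepeatHighPlateauxDeepTwo :=
  ⟨repeatHigh_of_joint, joint_of_repeatHigh⟩

/-- … hence lens-5's joint residual ⟺ the cone-line residual (PROVED). [new] [folklore] -/
theorem joint_iff_coneLine : NoRepeatTranslationRecurrentExcessPlateauxDeep ↔ NoConeLineRepeatHighPlateauxDeep :=
  joint_iff_repeatHigh.trans repeatHigh_iff_coneLine

/-! ### §D.6 THE ONE CERTIFIED EQUIV and the kernels BY NAME -/

/-- **THE ONE CERTIFIED EQUIV of g15 (PROVED): g14's located residual ⟺ rigid free high floors ∧ cone-line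
repeat-recurrent high plateaux.** [new] [folklore] -/
theorem highTwo_iff_cone :
    NoHighPlateauxDeepTwo ↔ NoRigidFreeHighFloorsDeep ∧ NoConeLineRepeatHighPlateauxDeep := by
  rw [highTwo_iff_free_repeat, freeHigh_iff_rigid, repeatHigh_iff_coneLine]

/-- The FULL EXACT CUT of g15 with both decided cells displayed. [folklore] -/
theorem highTwo_iff_four : NoHighPlateauxDeepTwo ↔
    (NoDriftingFreeHighPlateauxDeep ∧ NoRigidFreeHighFloorsDeep) ∧
      (NoBinaryRepeatHighPlateauxDeep ∧ NoConeLineRepeatHighPlateauxDeep) := by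
  rw [highTwo_iff_free_repeat, freeHigh_iff_drifting_rigid, repeatHigh_iff_binary_coneLine]

/-- **31770's class ⟺ the pieces, modulo g12's DECIDED origin-tail law (PROVED).** [new] [folklore] -/
theorem defectDeep_iff_pieces'' (hO : NoOriginTails) :
    DefectWalksTerminateDeep ↔ NoLoadedCriticalPlateauxDeep ∧ NoFloorTailsDeep ∧
      NoRigidFreeHighFloorsDeep ∧ NoConeLineRepeatHighPlateauxDeep := by
  rw [defectDeep_iff_pieces' hO, highTwo_iff_cone]

open Summit.ResolutionOfSingularities.ResolutionOfSingularities.Theses in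
/-- **Aside 31770 `MaxContactCut.DefectWalksDeep` from the pieces, BY NAME** (31871 discharged from the tree's
`NoJump`). [new] [folklore] -/
theorem defectWalksDeep_of_pieces'' (hO : NoOriginTails) (hL : NoLoadedCriticalPlateauxDeep) (hT : NoFloorTailsDeep)
    (hF : NoRigidFreeHighFloorsDeep) (hC : NoConeLineRepeatHighPlateauxDeep) : MaxContactCut.DefectWalksDeep :=
  defectWalksDeep_of_pieces' hO hL hT (highTwo_iff_cone.mpr ⟨hF, hC⟩)

open Summit.ResolutionOfSingularities.ResolutionOfSingularities.Theses in
/-- **Aside 31870 `MaxContactCut.ICNoPlateauDeep` from the pieces, BY NAME.** [new] [folklore] -/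
theorem icNoPlateauDeep_of_pieces'' (hO : NoOriginTails) (hL : NoLoadedCriticalPlateauxDeep) (hT : NoFloorTailsDeep)
    (hF : NoRigidFreeHighFloorsDeep) (hC : NoConeLineRepeatHighPlateauxDeep) : MaxContactCut.ICNoPlateauDeep :=
  icNoPlateauDeep_of_pieces hO hL hT (highTwo_iff_cone.mpr ⟨hF, hC⟩)

open Summit.ResolutionOfSingularities.ResolutionOfSingularities.Theses in
/-- **Aside 31770 from the DEEP ARC LAW and the cone-line residual** (the free half discharged to the port). [new] [folklore] -/
theorem defectWalksDeep_of_arc_cone (hO : NoOriginTails) (hL : NoLoadedCriticalPlateauxDeep) (hT : NoFloorTailsDeep)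
    (hA : NoFreePointTailsDeep) (hC : NoConeLineRepeatHighPlateauxDeep) : MaxContactCut.DefectWalksDeep :=
  defectWalksDeep_of_pieces'' hO hL hT (rigidFree_of_freeTails hA) hC

open Summit.ResolutionOfSingularities.ResolutionOfSingularities.Theses in
/-- Necessity of the rigid-floor cell from 31770, BY NAME (unconditional). [new] [folklore] -/
theorem rigidFree_of_defectWalksDeep (h : MaxContactCut.DefectWalksDeep) : NoRigidFreeHighFloorsDeep :=
  (highTwo_iff_cone.mp (highTwo_of_defectWalksDeep h)).1

open Summit.ResolutionOfSingularities.ResolutionOfSingularities.Theses in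
/-- Necessity of the cone-line residual from 31770, BY NAME (unconditional). [new] [folklore] -/
theorem coneLine_of_defectWalksDeep (h : MaxContactCut.DefectWalksDeep) : NoConeLineRepeatHighPlateauxDeep :=
  (highTwo_iff_cone.mp (highTwo_of_defectWalksDeep h)).2

open Summit.ResolutionOfSingularities.ResolutionOfSingularities.Theses in
/-- Necessity of the two DECIDED cells from 31770 (they are genuine sub-pieces, not side remarks). [folklore] -/
theorem decided_of_defectWalksDeep (h : MaxContactCut.DefectWalksDeep) :
    NoDriftingFreeHighPlateauxDeep ∧ NoBinaryRepeatHighPlateauxDeep :=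
  ⟨drifting_of_freeHigh (freeHigh_of_highTwo (highTwo_of_defectWalksDeep h)),
    binaryRepeat_of_repeatHigh (repeatHigh_of_highTwo (highTwo_of_defectWalksDeep h))⟩

open Summit.ResolutionOfSingularities.ResolutionOfSingularities.Theses in
/-- **Aside 31770 ⟺ rigid free high floors ∧ cone-line repeats, modulo the decided / ported pieces (PROVED).**
[new] [folklore] -/
theorem defectWalksDeep_iff_cone (hO : NoOriginTails) (hL : NoLoadedCriticalPlateauxDeep) (hT : NoFloorTailsDeep) :
    MaxContactCut.DefectWalksDeep ↔ NoRigidFreeHighFloorsDeep ∧ NoConeLineRepeatHighPlateauxDeep :=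
  (defectWalksDeep_iff_high' hO hL hT).trans highTwo_iff_cone

open Summit.ResolutionOfSingularities.ResolutionOfSingularities.Theses in
/-- **Aside 31770 ⟺ THE cone-line residual ALONE, modulo the decided pieces, the floor port and the arc-law port
(PROVED).** [new] [folklore] -/
theorem defectWalksDeep_iff_coneLine (hO : NoOriginTails) (hL : NoLoadedCriticalPlateauxDeep) (hT : NoFloorTailsDeep)
    (hA : NoFreePointTailsDeep) : MaxContactCut.DefectWalksDeep ↔ NoConeLineRepeatHighPlateauxDeep :=
  ⟨coneLine_of_defectWalksDeep, fun hC => defectWalksDeep_of_arc_cone hO hL hT hA hC⟩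

open Summit.ResolutionOfSingularities.ResolutionOfSingularities.Theses in
/-- **Aside 31770 ⟺ the THREE located residual cores, modulo the decided pieces and the floor port (PROVED, rev
3).** [new] [folklore] -/
theorem defectWalksDeep_iff_three (hO : NoOriginTails) (hL : NoLoadedCriticalPlateauxDeep) (hT : NoFloorTailsDeep) :
    MaxContactCut.DefectWalksDeep ↔ NoRigidFreeHighFloorsDeep ∧ NoRigidAllRepeatTailsDeep ∧ NoMixedTailsDeep :=
  (defectWalksDeep_iff_high' hO hL hT).trans highTwo_iff_three

open Summit.ResolutionOfSingularities.ResolutionOfSingularities.Theses in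
/-- **Aside 31770 ⟺ rigid all-repeat core ∧ mixed words, modulo the decided pieces, the floor port and the arc-law
port (PROVED, rev 3).** [new] [folklore] -/
theorem defectWalksDeep_iff_rigid_mixed (hO : NoOriginTails) (hL : NoLoadedCriticalPlateauxDeep)
    (hT : NoFloorTailsDeep) (hA : NoFreePointTailsDeep) :
    MaxContactCut.DefectWalksDeep ↔ NoRigidAllRepeatTailsDeep ∧ NoMixedTailsDeep :=
  (defectWalksDeep_iff_coneLine hO hL hT hA).trans coneLine_iff_rigid_mixed

open Summit.ResolutionOfSingularities.ResolutionOfSingularities.Theses in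
/-- Necessity of the two located cores from 31770, BY NAME (unconditional). [folklore] -/
theorem rigidAllRepeat_of_defectWalksDeep (h : MaxContactCut.DefectWalksDeep) : NoRigidAllRepeatTailsDeep :=
  rigidAllRepeat_of_allRepeat (allRepeat_of_repeatHigh (repeatHigh_of_highTwo (highTwo_of_defectWalksDeep h)))

open Summit.ResolutionOfSingularities.ResolutionOfSingularities.Theses in
/-- `mixed_of_defectWalksDeep`: Auxiliary step of this node's calculus, VERBATIM from the lens file (see the module docstring); the statement is its type. [folklore] -/
theorem mixed_of_defectWalksDeep (h : MaxContactCut.DefectWalksDeep) : NoMixedTailsDeep :=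
  mixed_of_repeatHigh (repeatHigh_of_highTwo (highTwo_of_defectWalksDeep h))

open Summit.ResolutionOfSingularities.ResolutionOfSingularities.Theses in
/-- **Aside 31770 ⟺ rigid free floors ∧ mixed words, modulo the decided pieces and the floor port (PROVED, rev
4).** [new] [folklore] -/
theorem defectWalksDeep_iff_free_mixed (hO : NoOriginTails) (hL : NoLoadedCriticalPlateauxDeep)
    (hT : NoFloorTailsDeep) : MaxContactCut.DefectWalksDeep ↔ NoRigidFreeHighFloorsDeep ∧ NoMixedTailsDeep :=
  (defectWalksDeep_iff_high' hO hL hT).trans highTwo_iff_free_mixed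

open Summit.ResolutionOfSingularities.ResolutionOfSingularities.Theses in
/-- **Aside 31770 ⟺ MIXED WORDS ALONE, modulo the decided pieces, the floor port and the arc-law port (PROVED,
rev 4).** [new] [folklore] -/
theorem defectWalksDeep_iff_mixed (hO : NoOriginTails) (hL : NoLoadedCriticalPlateauxDeep) (hT : NoFloorTailsDeep)
    (hA : NoFreePointTailsDeep) : MaxContactCut.DefectWalksDeep ↔ NoMixedTailsDeep :=
  (defectWalksDeep_iff_coneLine hO hL hT hA).trans coneLine_iff_mixed

open Summit.ResolutionOfSingularities.ResolutionOfSingularities.Theses in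
/-- **Aside 31770 ⟺ TAME mixed words, modulo the decided pieces, the floor port and the arc-law port (PROVED,
rev 4).** [new] [folklore] -/
theorem defectWalksDeep_iff_tame (hO : NoOriginTails) (hL : NoLoadedCriticalPlateauxDeep) (hT : NoFloorTailsDeep)
    (hA : NoFreePointTailsDeep) : MaxContactCut.DefectWalksDeep ↔ NoTameMixedTailsDeep :=
  (defectWalksDeep_iff_mixed hO hL hT hA).trans mixed_iff_tame

open Summit.ResolutionOfSingularities.ResolutionOfSingularities.Theses in
/-- **Aside 31770 ⟺ rigid free floors ∧ tame mixed words, modulo the decided pieces and the floor port (PROVED,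
rev 4).** [new] [folklore] -/
theorem defectWalksDeep_iff_free_tame (hO : NoOriginTails) (hL : NoLoadedCriticalPlateauxDeep)
    (hT : NoFloorTailsDeep) : MaxContactCut.DefectWalksDeep ↔ NoRigidFreeHighFloorsDeep ∧ NoTameMixedTailsDeep :=
  (defectWalksDeep_iff_free_mixed hO hL hT).trans (and_congr_right fun _ => mixed_iff_tame)

/-! ## §E ROOT BY NAME: `_root_.ResolutionOfSingularities` from the MaxContactCut cruxes is the landed
`Theorems.MaxContactCutExponentLadder.closes` (this node is an aside ladder under 31770 / 31870; no restatement). -/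

end Summit.ResolutionOfSingularities.ResolutionOfSingularities.Theorems.ConeCut
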